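import Summits.QuantumFields.YangMills.Theorems.UnitScaleTiltHalvingP1FlatCoreSupplierLowerFamily
import Literature.MathematicalPhysics.QuantumFieldTheory.Balaban1983to89.B8SockHFPRD
import Literature.MathematicalPhysics.QuantumFieldTheory.Balaban1983to89.B8Prop5JoinSectELocalRDW
import HarnessLib

/-!
# `hP1room` PROGRAMME (LEAD-H «H = hSupUρ», RULING L-11∕g27-№9), (A-1) [R-h]-c: ★★ (1.29) OF THE COMPOSITE GAUGE `u₁·e^{iλ′}` BELOW THE TOP, FROM THE TOP-STEP CALL's
# (lo) ROW AND THEOREM 4's DATUM — the `h129` guard row of ✓p647823 `HalvingP1FlatCoreTopSizes.hX_of_topRows` and ✓p645668 `P1FlatCoreTopH42.H42_top_guarded`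

Route `UnitScaleTilt`, crux K1 child «MinimiserStabilityRegPr» (stmt-QuantumFields-19200), registered stub `stub_halvingStep` (`BirthV10`), text `hP1roomρ ⟸ hSupUρ`.
Cell `ym3-torus` (HUMAN RULING D-0037: YM₃ on T³ is ladder rung R3 — NOT d = 4, NOT a mass gap, NOT the Clay problem), width seat `ym-ust-20520-w3` gen 6.
`--supports stmt-QuantumFields-19200 --as helper`; THEOREMS ONLY (0 `def`, 0 `sorry`); count-neutral; nothing here claims `core′`, `hP1room(ρ)`, `hSupU(ρ)`, the stub, the crux or the gap.

WHAT.  ★★ `restr129_product_of_topRows` — in the letters of ✓p646092 `HalvingP1FlatCoreSupplierTopCall.topRows_of_datum` (its datum∕tower∕window binders, a subset) and from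
two of its OUTPUT rows — (1.108) `‖λ′‖, |∇λ′| ≤ α₄` on the sides touching the member's domains and (lo) `Q′_j(1; e^{−iλ′}, u₁⁻¹)(y) = 0` for `j < m+1`, `y ∈ Λs (m+1) j` —
the (1.29) restriction of the PRODUCT gauge `u₁ · e^{iλ′}` on the member's tower structure WITH THE TOP LEVEL EMPTIED:
`Restr129 L (m+1) (Function.update (Λs (m+1)) (m+1) ∅) 1 (u₁ * gaugeExp λ′)` («(1.29) of the composite gauge below the top», Thm 4 p.90 ∕ Prop. 5 p.94).
MECHANISM = N05's JOIN-B template ✓`B8Prop5JoinSectELocalRDW.restr129_mul_gaugeExp_local_w` BY NAME: masked datum (✓`exists_masked_datum`) → N05's datum binders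
(✓`B8Prop5SocketDatum`: (1.33) on the towers, (1.68)–(1.69) rows, the axial class of `U₁^{u₁}`, (1.29) of `u₁` lifted to the finer structure) → unitary tower witnesses of `u₁`
(✓`witness_unitary_of_glev` ∘ ✓`glev_on_towers_of_axial`, radius `40·d·c_B`) → the (207)-rows of `−iλ′` at `2α₄` on the towers ((1.108) read on tower bonds, ✓`sideTouches_of_tower_bond`,
✓`cjDiff_le_of_weighted`) → ✓`B8Restr129InversionLocal.restr129_mul_inv_of_cond179_local` with (1.79) = (lo) below the top (top vacuous) → `(e^{−iλ′})⁻¹ = gaugeExp λ′`.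
INHABITABILITY: every input is a binder ✓p646092 already carries or a row it OUTPUTS — no new window.

References: T. Bałaban, CMP **99** (1985) 75–102 [Balaban1985RegularSpaces] ((1.29) p.81, (1.68)–(1.69) p.88, (1.78)–(1.79) p.90, (1.108) p.94, (1.112)–(1.114) p.95);
CMP **98** (1985) 17–51 [Balaban1985Averaging] (Prop. 10 (203)–(207) p.50).
-/

set_option autoImplicit false

noncomputable section

open scoped BigOperators
open NormedSpace
open Complex (I)

namespace Summit.QuantumFields.YangMills.Theorems.HalvingP1FlatCoreSupplierRestr129

open Literature.MathematicalPhysics.QuantumFieldTheory.Balaban1983to89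
open B7Prop1Explicit (Site e expUnit val_inv_expUnit)
open B7Prop2Explicit (unitaryUnits C0 c2')
open B7Prop3Flat (c3)
open B7Prop10General (C6 C4G)
open B7Prop10Flat (one_le_C5)
open B7Prop9Flat (C5')
open B7Prop1Local (InBox pdevOn clampCfg)
open B7Eq167Flat (InLambda)
open B7Eq170Flat (cj)
open B7Eq92Concrete (mgauge)
open B8Ineq130 (tlo thi)
open B8Ineq132 (covDerivFwd InAk)
open B8Eq119TwistedAxial (Restr129 InAx)
open B8Eq184Proof (gaugeExp cfgExp)
open B8Lemma1NonAbelian (mulCfg)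
open B8Eq140Level (SideTouches)
open B8Eq146AExpansion (iEta)
open B8Thm2LogB (blockTop norm_negI_smul)
open B8Eq155JBound (expCfg_iEta_mem_unitaryUnits)
open B8LambdaSpaceKLevel (wt)
open B8Eq178Averages (Qnl Cond179)
open B8Eq1123Concrete (cj_smul_complex)
open B8Prop5JoinSectE (cjDiff_le_of_weighted)
open B8Prop5SocketDatum (exists_masked_datum restr129_succ_of_truncation sideTouches_of_tower_bond h33_of_inAk hP_of_datum h69_of_datum)
open B8SockHFPAssembly (inAx_mgauge_expCfg_of_datum)
open B8SectEInLambdaWitness (witness_unitary_of_glev)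
open B8Eq1117KLevel (glev_on_towers_of_axial)
open B8Restr129InversionLocal (restr129_mul_inv_of_cond179_local)
open Literature.MathematicalPhysics.QuantumLattice (blockSites)

variable {d : ℕ} {𝔸 : Type*} [CStarAlgebra 𝔸] [Nontrivial 𝔸]

/-- ★★ **(1.29) OF THE COMPOSITE GAUGE `u₁·e^{iλ′}` BELOW THE TOP** — see the module docstring: from Theorem 4's datum at level `m` (N05's letters), the member's tower structure
and windows (✓p646092's binders), and the top-step call's OUTPUT rows (1.108) and (lo) for `λ′`:
`Restr129 L (m+1) (Function.update (Λs (m+1)) (m+1) ∅) 1 (u₁ * gaugeExp λ′)`.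
[cite: Balaban1985RegularSpaces, (1.29) p.81, (1.68)-(1.69) p.88, (1.78)-(1.79) p.90, (1.108) p.94, (1.112)-(1.114) p.95; Balaban1985Averaging, Prop. 10 (203)-(207) p.50] -/
theorem restr129_product_of_topRows (hd2 : 2 ≤ d) {L : ℕ} (hL : 2 ≤ L) {η : ℝ} (hη : 0 < η) {K₀ : ℕ}
    -- the member's geometry (domains, tower structures at `m` and `m+1`)
    {Ω : ℕ → Set (Site d)} (hΩ : ∀ j, Ω (j + 1) ⊆ Ω j) {Λs : ℕ → ℕ → Set (Site d)}
    {m : ℕ} (hmk : m < K₀)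
    (htower : ∀ j, j ≤ m + 1 → ∀ y ∈ Λs (m + 1) j, ∀ x, InBox (tlo L y j) (thi L y j) x → x ∈ Ω j)
    (hlt : ∀ j, j < m → Λs m j = Λs (m + 1) j)
    (htop : ∀ x, x ∈ Λs m m ↔ x ∈ Λs (m + 1) m ∨ ∃ y ∈ Λs (m + 1) (m + 1), x ∈ blockSites L y)
    -- constants, (1.33), (1.34), the axial class of the pre-gauged field `U′` at the flat background
    {α₀ α₁ B₀ cs α₄ : ℝ} (hα₀ : 0 < α₀) (hα₁ : 0 < α₁) (hB₀ : 0 < B₀) (hα₄ : 0 < α₄)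
    (hcs : cs = 5 * (d : ℝ) * L * B₀ * (α₀ + α₁))
    {U' : Site d → Fin d → 𝔸ˣ}
    (h33 : InAk L K₀ η α₀ Ω (1 : Site d → Fin d → 𝔸ˣ)) (h34 : InAk L K₀ η α₀ Ω (mulCfg U' 1))
    (hAx : ∀ m', m' ≤ K₀ → InAx L m' (Λs m') (1 : Site d → Fin d → 𝔸ˣ) (mulCfg U' 1))
    -- the datum at level `m`
    {u₁ : Site d → 𝔸ˣ} {U₁ : Site d → Fin d → 𝔸ˣ} {A : Site d → Fin d → 𝔸}
    (hu₁ : ∀ x, u₁ x ∈ unitaryUnits 𝔸) (hW : mgauge (1 : Site d → Fin d → 𝔸ˣ) u₁ U₁ = U') (h129 : Restr129 L m (Λs m) (1 : Site d → Fin d → 𝔸ˣ) u₁)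
    (hdat : ∀ j, j ≤ m → ∀ b ∈ {b : Site d × Fin d | SideTouches (Ω j) b.1 b.2},
      U₁ b.1 b.2 = cfgExp η A b.1 b.2 ∧ IsSelfAdjoint (A b.1 b.2) ∧ ‖A b.1 b.2‖ ≤ cs * ((L : ℝ) ^ j * η)⁻¹)
    -- the JOIN's scalar windows (✓p646092's, the subset read here)
    {cB : ℝ} (hcBlo : L * cs ≤ cB)
    (hα3 : C0 d * α₀ ≤ 1 / 3) (hα4 : 4 * α₀ ≤ c2' d L)
    (hsmall : Real.exp (4 * (800 * ((d : ℝ) + 1) ^ 2 * ((d : ℝ) + 4)) * α₀) * (1 + 8 * (131072 * ((d : ℝ) + 1) ^ 2) * cB) ≤ 2)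
    (hc₃ : 2 * cB ≤ c3 d L) (hsc : 2048 * (d : ℝ) * cB ≤ 1) (hα₃' : 40 * d * cB ≤ 1 / 200)
    (hs₁ : 200 * C6 d * (2 * α₄) ≤ 1) (hs₂ : 12000 * ((d : ℝ) + 1) * L * (2 * α₄) ≤ 1)
    (hs₃ : C4G d L * (α₀ + 40 * d * cB + 4 * (2 * α₄)) ≤ 1)
    (hs₄ : 1024 * ((d : ℝ) + 1) * ((d : ℝ) + 4) * L ^ 2 * α₀ ≤ 1) (hs₅ : 32 * ((d : ℝ) + 1) ^ 2 * C6 d * L ^ 2 * α₀ ≤ 1)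
    (hs₆ : 16 * d * C5' d * C6 d * (L : ℝ) ^ 2 * α₀ ≤ 1)
    (hprod8 : 2 * C6 d * (40 * d * cB + 4 * α₄) ≤ 1 / 8)
    -- the top-step call's OUTPUT rows for `λ′`: (1.108) on the touched sides, (lo) below the top
    {lam : Site d → 𝔸}
    (h108 : ∀ j, j ≤ m + 1 → ∀ b ∈ {b : Site d × Fin d | SideTouches (Ω j) b.1 b.2},
      ‖lam b.1‖ ≤ α₄ ∧ wt L η j * ‖covDerivFwd η (1 : Site d → Fin d → 𝔸ˣ) b.2 lam b.1‖ ≤ α₄)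
    (hlo : ∀ j, j < m + 1 → ∀ y ∈ Λs (m + 1) j, Qnl L (1 : Site d → Fin d → 𝔸ˣ) (expUnit ∘ ((-I) • lam)) u₁⁻¹ j y = 0) :
    Restr129 L (m + 1) (Function.update (Λs (m + 1)) (m + 1) ∅) (1 : Site d → Fin d → 𝔸ˣ) (u₁ * gaugeExp lam) := by
  subst hcs
  have hU₀ : ∀ (x : Site d) (κ : Fin d), (1 : Site d → Fin d → 𝔸ˣ) x κ ∈ unitaryUnits 𝔸 := fun _ _ => (unitaryUnits 𝔸).one_mem
  have hL1 : 1 ≤ L := le_trans (by norm_num) hL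
  have hd1 : 1 ≤ d := le_trans (by norm_num) hd2
  have hLr : (1 : ℝ) ≤ L := by exact_mod_cast hL1
  have hmK : m + 1 ≤ K₀ := hmk
  have hcs0 : 0 ≤ 5 * (d : ℝ) * L * B₀ * (α₀ + α₁) := by positivity
  have hcsB : 5 * (d : ℝ) * L * B₀ * (α₀ + α₁) ≤ cB := (le_mul_of_one_le_left hcs0 hLr).trans hcBlo
  have hcB0 : 0 ≤ cB := hcs0.trans hcsB
  have hαP2 : 2 * α₀ ≤ c2' d L := by linarith only [hα4, hα₀]
  have hC6 : (0 : ℝ) ≤ C6 d := by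
    have : (2 : ℝ) ≤ C6 d := by unfold C6; linarith only [one_le_C5 (d := d)]
    linarith only [this]
  have hα₃0 : (0 : ℝ) ≤ 40 * d * cB := by positivity
  -- the MASKED exponent `A′` of the datum and N05's datum binders BY NAME (as ✓p646092)
  obtain ⟨A', hsa, _, hWA, _⟩ := exists_masked_datum hdat
  have hWA1 : ∀ j, j ≤ m → ∀ (y : Site d) (τ : Fin d), SideTouches (Ω j) y τ → U₁ y τ = cfgExp η A' y τ :=
    fun j hj y τ hs => (hWA j hj y τ hs).1
  have h41 : ∀ j, j ≤ m → ∀ (y : Site d) (τ : Fin d), SideTouches (Ω j) y τ →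
      ‖A' y τ‖ ≤ (5 * (d : ℝ) * L * B₀ * (α₀ + α₁)) * ((L : ℝ) ^ j * η)⁻¹ := fun j hj y τ hs => (hWA j hj y τ hs).2
  have h33' := h33_of_inAk hL1 hα₀ h33 hmK htower
  have hP' := hP_of_datum hL1 hα₀ hΩ h34 hmK htower hu₁ hW hWA1
  have h69' : ∀ j, j ≤ m + 1 → ∀ y ∈ Λs (m + 1) j, ∀ (x : Site d) (κ : Fin d), InBox (tlo L y j) (thi L y j) x →
      InBox (tlo L y j) (thi L y j) (x + e κ) → ‖iEta η A' x κ‖ ≤ cB * ((L : ℝ) ^ j)⁻¹ :=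
    fun j hj y hy x κ hx hxe =>
      (h69_of_datum hd2 hL1 hη hΩ htower hcs0 h41 j hj y hy x κ hx hxe).trans (mul_le_mul_of_nonneg_right hcBlo (by positivity))
  have hBu : ∀ (x : Site d) (κ : Fin d), B8Eq146AExpansion.expCfg (iEta η A') x κ ∈ unitaryUnits 𝔸 := expCfg_iEta_mem_unitaryUnits η hsa
  have hAx' : InAx L (m + 1) (Λs (m + 1)) (1 : Site d → Fin d → 𝔸ˣ)
      (mgauge (1 : Site d → Fin d → 𝔸ˣ) u₁ (B8Eq146AExpansion.expCfg (iEta η A')) * (1 : Site d → Fin d → 𝔸ˣ)) :=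
    inAx_mgauge_expCfg_of_datum hd2 hL1 hΩ htower hW hWA1 (hAx (m + 1) hmK)
  have h129' : Restr129 L (m + 1) (Λs (m + 1)) (1 : Site d → Fin d → 𝔸ˣ) u₁ := restr129_succ_of_truncation hL1 hlt htop h129
  -- the tower structure with the top emptied
  have hsub : ∀ {j : ℕ} {y : Site d}, y ∈ Function.update (Λs (m + 1)) (m + 1) ∅ j → j ≠ m + 1 ∧ y ∈ Λs (m + 1) j := by
    intro j y hy
    by_cases hj : j = m + 1
    · subst hj; simp at hy
    · rw [Function.update_of_ne hj] at hy
      exact ⟨hj, hy⟩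
  -- unitary tower witnesses of `u₁` (radius `40·d·c_B`) from the axial class and (1.29)
  have hglev := glev_on_towers_of_axial hL1 (Λs (m + 1)) hAx' h129'
  have hwit : ∀ j, j ≤ m + 1 → ∀ y ∈ Function.update (Λs (m + 1)) (m + 1) ∅ j, ∃ ut : Site d → 𝔸ˣ, (∀ x, ut x ∈ unitaryUnits 𝔸) ∧
      InLambda L (clampCfg (tlo L y j) (thi L y j) (1 : Site d → Fin d → 𝔸ˣ)) ut j (40 * d * cB) (((L : ℝ) ^ j)⁻¹) ∧
      ∀ x : Site d, tlo L y j ≤ x → x ≤ thi L y j → u₁ x = ut x := fun j hj y hy =>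
    witness_unitary_of_glev hd1 hL hU₀ hα₀ hα3 hα4 (h33' j hj y (hsub hy).2) hcB0 hsmall hc₃ hsc hα₀ hα3 hαP2 hL1 hBu (h69' j hj y (hsub hy).2)
      (hP' j hj y (hsub hy).2) (hglev j hj y (hsub hy).2)
  -- the (207)-rows of `−iλ′` on the towers at `2α₄`, from (1.108) on the tower bonds
  have hκ₀ : Fin d := ⟨0, by omega⟩
  have h177b : ∀ j, j ≤ m + 1 → ∀ y ∈ Function.update (Λs (m + 1)) (m + 1) ∅ j, ∀ x : Site d, InBox (tlo L y j) (thi L y j) x →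
      ‖((-I) • lam) x‖ < 2 * α₄ := by
    intro j hj y hy x hx
    rw [Pi.smul_apply, norm_negI_smul]
    have h := (h108 j hj (x, hκ₀) (sideTouches_of_tower_bond hd2 htower hj (hsub hy).2 x hκ₀ hx)).1
    linarith only [h, hα₄]
  have h177a : ∀ j, j ≤ m + 1 → ∀ y ∈ Function.update (Λs (m + 1)) (m + 1) ∅ j, ∀ (x : Site d) (κ : Fin d), InBox (tlo L y j) (thi L y j) x →
      InBox (tlo L y j) (thi L y j) (x + e κ) → ‖cj ((1 : Site d → Fin d → 𝔸ˣ) x κ) (((-I) • lam) (x + e κ)) - ((-I) • lam) x‖ < 2 * α₄ * ((L : ℝ) ^ j)⁻¹ := by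
    intro j hj y hy x κ hx _
    have hLj : (0 : ℝ) < ((L : ℝ) ^ j)⁻¹ := by
      have : (0 : ℝ) < L := by exact_mod_cast hL1
      positivity
    have hgrad := (h108 j hj (x, κ) (sideTouches_of_tower_bond hd2 htower hj (hsub hy).2 x κ hx)).2
    rw [Pi.smul_apply, Pi.smul_apply, cj_smul_complex, ← smul_sub, norm_negI_smul]
    calc ‖cj ((1 : Site d → Fin d → 𝔸ˣ) x κ) (lam (x + e κ)) - lam x‖ ≤ α₄ * ((L : ℝ) ^ j)⁻¹ := cjDiff_le_of_weighted hL1 hη hgrad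
      _ < 2 * α₄ * ((L : ℝ) ^ j)⁻¹ := mul_lt_mul_of_pos_right (by linarith) hLj
  -- the windows of the local inversion at `(α₃ := 40·d·c_B, 2α₄)`
  have hw₁ : 10 * C6 d * (4 * (2 * α₄)) ≤ 1 := by nlinarith only [hs₁, hC6, hα₄.le]
  have hw₂ : 3000 * ((d : ℝ) + 1) * L * (4 * (2 * α₄)) ≤ 1 := by linarith only [hs₂]
  have hprod : 2 * C6 d * (40 * d * cB + 4 * (2 * α₄)) < 1 / 2 := by nlinarith only [hprod8, hC6, hα₃0, hα₄.le]
  -- (1.33), (1.29) of `u₁` and (1.79) = (lo) on the emptied structure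
  have h33e : ∀ j, j ≤ m + 1 → ∀ y ∈ Function.update (Λs (m + 1)) (m + 1) ∅ j,
      pdevOn (tlo L y j) (thi L y j) (1 : Site d → Fin d → 𝔸ˣ) < α₀ * (((L : ℝ) ^ j)⁻¹) ^ 2 := fun j hj y hy => h33' j hj y (hsub hy).2
  have h129e : Restr129 L (m + 1) (Function.update (Λs (m + 1)) (m + 1) ∅) (1 : Site d → Fin d → 𝔸ˣ) u₁ :=
    fun j hj y hy => h129' j hj y (hsub hy).2
  have h179 : Cond179 L (m + 1) (Function.update (Λs (m + 1)) (m + 1) ∅) (1 : Site d → Fin d → 𝔸ˣ) (fun x => expUnit (((-I) • lam) x)) u₁⁻¹ :=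
    fun j hj y hy => hlo j (lt_of_le_of_ne hj (hsub hy).1) y (hsub hy).2
  have h := restr129_mul_inv_of_cond179_local (Λ := Function.update (Λs (m + 1)) (m + 1) ∅) (lam := (-I) • lam) hL hL1 hU₀ hα₀ hα3 hαP2 hα₃0
    (by linarith only [hα₃']) (by positivity) h33e hwit h177b h177a hw₁ hw₂ hs₃ hs₄ hs₅ hs₆ hprod h129e h179
  have hfun : (fun x => expUnit (((-I) • lam) x))⁻¹ = gaugeExp lam := by
    funext x
    rw [Pi.inv_apply, val_inv_expUnit, Pi.smul_apply, neg_smul, neg_neg]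
    rfl
  rw [hfun] at h
  exact h

end Summit.QuantumFields.YangMills.Theorems.HalvingP1FlatCoreSupplierRestr129

end
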